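import Literature.NumberTheory.Automorphic.AutomorphicForms
import Literature.NumberTheory.Automorphic.AutomorphicFormsSpan
import Literature.NumberTheory.Automorphic.ArchimedeanCalculusProofs
import Literature.NumberTheory.Automorphic.ArchimedeanApplyFreeCongr
import HarnessLib

/-!
# Automorphic forms are a smooth `G(𝔸_f)`-module — discharge of `isSmooth_finiteRep`

Topic `NumberTheory/Automorphic`; sibling proof file of `AutomorphicForms`, discharging its named
fact

* `AutomorphicRepData.isSmooth_finiteRep π` : for an automorphic representation
  `π = (W' < W ≤ 𝒜)` of a *regular* automorphy datum `𝒟` (`𝒟.IsRegular`), the representation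
  `π.finiteRep` of `G(𝔸_f)` on `W / W'` by right translation is smooth, i.e. every vector has an
  open stabiliser (Borel–Jacquet, Corvallis (1979), 4.2(a), 4.3, 4.6),

as `AutomorphicRepData.isSmooth_finiteRep_holds`, through the lemma
`isSmoothVector_of_mem_automorphicForms`: every element of the space of automorphic forms
`𝒜 = automorphicForms 𝒟` is a smooth vector for right translation restricted to `G(𝔸_f)`
(Borel–Jacquet 4.3: "as a `G(𝔸_f)`-module it is smooth").

Proof (as in print, three lines). An automorphic form `φ` is right invariant under some level
`U ∈ 𝒟.finiteLevels` (4.2(a), field `IsAutomorphicForm.exists_level`), and for a regular datum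
levels are open in `G(𝔸_f)` (`AutomorphyDatum.IsRegular.isOpen_level`); so `φ` is fixed by an
open subgroup, hence is a smooth vector (`Representation.isSmoothVector_of_mem_fixedPoints`).
Smooth vectors form a subspace (`Representation.smoothPart`), so the whole span `𝒜` consists of
smooth vectors. Finally the stabiliser of `[φ] ∈ W / W'` contains the stabiliser of `φ ∈ W ≤ 𝒜`
(`AutomorphicRepData.finiteRep_mk`), so it is open (`Representation.isSmoothVector_of_le`).
Directedness of the levels is not needed: finite intersections of open stabilisers are open.

Everything here is proved; no new definitions or named facts.

## References

* A. Borel, H. Jacquet, *Automorphic forms and automorphic representations*, Proc. Sympos. Pure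
  Math. 33 (Corvallis 1977), Part 1 (1979), 189–202, 4.2(a), 4.3, 4.6 [BorelJacquetCorvallis1979].
* J. R. Getz, H. Hahn, *An Introduction to Automorphic Representations*, GTM 300 (2024),
  Definition 6.5 and (6.7), p. 134 (the `(𝔤, K_∞) × G(𝔸_F^∞)`-action on `𝒜` by right
  translation; smooth = locally constant in the finite-adelic variable, (6.1)).
-/

namespace Literature.NumberTheory.Automorphic

variable {K : Type} [Field K] [NumberField K]
variable {A : Type*} [NormedCommRing A] [NormedAlgebra ℝ A] [NormedAlgebra ℚ A] [CompleteSpace A]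
  [StarRing A] {N : Type*} [Fintype N] [DecidableEq N]
variable {𝒢 : AdelicGroupData K}

section Forms

variable (𝒟 : AutomorphyDatum 𝒢 A N)

/-- The space of automorphic forms is a *smooth* `G(𝔸_f)`-module for a regular datum: every
`φ ∈ 𝒜 = automorphicForms 𝒟` is a smooth vector for right translation restricted to `G(𝔸_f)`,
i.e. its stabiliser in `G(𝔸_f)` is open. Indeed each automorphic form is right invariant under
a level `U` (4.2(a)), levels are open in `G(𝔸_f)` (`IsRegular.isOpen_level`), and smooth vectors
form a subspace (`Representation.smoothPart`). Borel–Jacquet, Corvallis (1979), 4.2(a) and 4.3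
("these actions define a structure of `(𝔤, K_∞) × G(𝔸_f)`-module; as a `G(𝔸_f)`-module it is
smooth"). [cite: BorelJacquetCorvallis1979, 4.2(a) and 4.3] -/
theorem isSmoothVector_of_mem_automorphicForms (h𝒟 : 𝒟.IsRegular) {φ : 𝒢.Adelic → ℂ}
    (hφ : φ ∈ automorphicForms 𝒟) :
    Representation.IsSmoothVector
      (MonoidHom.comp (rightTranslation 𝒢) 𝒟.finiteAdelic.subtype :
        Representation ℂ 𝒟.finiteAdelic (𝒢.Adelic → ℂ)) φ := by
  refine (Submodule.span_le (p := (Representation.smoothPart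
    (MonoidHom.comp (rightTranslation 𝒢) 𝒟.finiteAdelic.subtype :
      Representation ℂ 𝒟.finiteAdelic (𝒢.Adelic → ℂ))).toSubmodule)).mpr ?_ hφ
  intro ψ hψ
  obtain ⟨U, hU, hUψ⟩ := hψ.exists_level
  refine Representation.isSmoothVector_of_mem_fixedPoints _
    (K := U.comap 𝒟.finiteAdelic.subtype) (h𝒟.isOpen_level U hU) ?_
  rw [Representation.mem_fixedPoints]
  intro u hu
  funext g
  exact hUψ u hu g

end Forms

namespace AutomorphicRepData

variable {𝒟 : AutomorphyDatum 𝒢 A N} (π : AutomorphicRepData 𝒟)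

/-- **Discharge of `AutomorphicRepData.isSmooth_finiteRep`.** The `G(𝔸_f)`-action on `W / W'`
is smooth for a regular datum: a vector `[φ]`, `φ ∈ W ≤ 𝒜`, has stabiliser containing the
stabiliser of `φ` under right translation by `G(𝔸_f)`, which is open
(`isSmoothVector_of_mem_automorphicForms`: every automorphic form is right invariant under a
level, levels are open for a regular datum, and smooth vectors form a subspace).
Borel–Jacquet, Corvallis (1979), 4.2(a), 4.3 and 4.6. [cite: BorelJacquetCorvallis1979, 4.2(a), 4.3 and 4.6] -/
theorem isSmooth_finiteRep_holds : π.isSmooth_finiteRep := by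
  intro h𝒟 v
  induction v using Submodule.Quotient.induction_on with
  | H φ =>
    refine π.finiteRep.isSmoothVector_of_le
      (isSmoothVector_of_mem_automorphicForms 𝒟 h𝒟 (π.stable.le_automorphicForms φ.2))
      fun u hu ↦ ?_
    simp only [Representation.mem_stabilizerSubgroup] at hu ⊢
    rw [finiteRep_mk]
    congr 1
    exact Subtype.ext hu

end AutomorphicRepData

end Literature.NumberTheory.Automorphic

/-!
# Appendix (2026-08-15): the span of the automorphic forms consists of automorphic forms —
# discharge of `mem_automorphicForms_iff` for every automorphy datum

The named fact `mem_automorphicForms_iff 𝒟` of `AutomorphicForms` (Borel–Jacquet 4.3, first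
assertion: "`𝒜` is a complex vector space", i.e. sums and scalar multiples of automorphic forms
are automorphic, granted directed levels and finite-dimensional coefficients) was proved in
`AutomorphicFormsSpan` for data whose archimedean group is a *full* linear group
(`mem_automorphicForms_iff_of_top`, `_gl`), because the additivity of `Z(𝔤)`-finiteness needs the
iterated Lie derivatives of a smooth function to be smooth, which was available only for
`𝔤 = 𝔤𝔩(N, A)`. With `isArchSmooth_lieDeriv_holds` (`ArchimedeanCalculusProofs`: Lie derivatives
preserve smoothness along `exp 𝔤` for ANY linear real group, through the exponential coordinates
of `Literature.Analysis.Calculus.ExpLocalLieSubalgebra`) the same assembly goes through in general: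

* `IsArchSmooth.iterLieDeriv_of_isArchSmooth_lieDeriv`, `iterLieDeriv_add_of_isArchSmooth_lieDeriv`,
  `applyFree_add_right_of_isArchSmooth_lieDeriv` — the word action `p φ` of `p ∈ ℝ⟨𝔤⟩` is additive
  on archimedean-smooth functions (BJ §1.5);
* `zOrbitSpan_add_le_of_isArchSmooth_lieDeriv`, `IsZFinite.add_of_isArchSmooth_lieDeriv` —
  `Z(φ + ψ) ⊆ Z φ + Z ψ`, so `Z(𝔤)`-finiteness is additive on smooth functions (BJ §1.6);
* `IsAutomorphicForm.add_of_isArchSmooth_lieDeriv`, `mem_automorphicForms_iff_of_isArchSmooth_lieDeriv`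
  (stated with the named fact `isArchSmooth_lieDeriv` as an explicit hypothesis, any datum), and
  the closed discharge `mem_automorphicForms_iff_holds : mem_automorphicForms_iff 𝒟`.

Everything is proved; no new definitions or named facts. References: Borel–Jacquet (1979), 4.2–4.3,
§1.5–1.6 [BorelJacquetCorvallis1979]; Getz–Hahn, GTM 300 (2024), Def. 6.2 and Def. 6.5 (p. 118).
-/

namespace Literature.NumberTheory.Automorphic

/-! ### `Z(𝔤)`-finiteness is additive on smooth functions (any linear real group) -/

section ZFiniteGeneral

variable {A : Type*} [NormedCommRing A] [NormedAlgebra ℝ A] [NormedAlgebra ℚ A] [CompleteSpace A]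
  [StarRing A] {N : Type*} [Fintype N] [DecidableEq N] {H : RealMatrixGroup A N}
  {G : Type*} [Group G] (ι : H.carrier →* G) [FiniteDimensional ℝ A]

/-- Iterated Lie derivatives of an archimedean-smooth function are archimedean-smooth, for any
linear real group, granted the named fact `isArchSmooth_lieDeriv` of `ArchimedeanCalculus`
(Lie derivatives of smooth functions are smooth). Borel–Jacquet 1979, §1.5. [cite: BorelJacquetCorvallis1979, §1.5] -/
theorem IsArchSmooth.iterLieDeriv_of_isArchSmooth_lieDeriv (hsm : isArchSmooth_lieDeriv (ι := ι))
    {φ : G → ℂ} (hφ : IsArchSmooth ι φ) : ∀ w : List H.lie, IsArchSmooth ι (iterLieDeriv ι w φ)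
  | [] => hφ
  | X :: w => by
    rw [iterLieDeriv_cons]
    exact hsm X (IsArchSmooth.iterLieDeriv_of_isArchSmooth_lieDeriv hsm hφ w)

/-- **Iterated Lie derivatives are additive on smooth functions**: `w (φ + ψ) = w φ + w ψ` for
archimedean-smooth `φ, ψ` and every word `w` (induction on `w`, using the additivity of a single
Lie derivative on smooth functions, `IsArchSmooth.lieDeriv_add`, and the smoothness of the
iterated derivatives). Borel–Jacquet 1979, §1.5. [cite: BorelJacquetCorvallis1979, §1.5] -/
theorem iterLieDeriv_add_of_isArchSmooth_lieDeriv (hsm : isArchSmooth_lieDeriv (ι := ι))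
    {φ ψ : G → ℂ} (hφ : IsArchSmooth ι φ) (hψ : IsArchSmooth ι ψ) :
    ∀ w : List H.lie, iterLieDeriv ι w (φ + ψ) = iterLieDeriv ι w φ + iterLieDeriv ι w ψ
  | [] => rfl
  | X :: w => by
    rw [iterLieDeriv_cons, iterLieDeriv_cons, iterLieDeriv_cons,
      iterLieDeriv_add_of_isArchSmooth_lieDeriv hsm hφ hψ w]
    exact IsArchSmooth.lieDeriv_add ι X (hφ.iterLieDeriv_of_isArchSmooth_lieDeriv ι hsm w)
      (hψ.iterLieDeriv_of_isArchSmooth_lieDeriv ι hsm w)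

/-- **The word action is additive on smooth functions**: `p (φ + ψ) = p φ + p ψ` for
`p ∈ ℝ⟨𝔤⟩` and archimedean-smooth `φ, ψ` (any linear real group, granted
`isArchSmooth_lieDeriv`). Borel–Jacquet 1979, §1.5–1.6. [cite: BorelJacquetCorvallis1979, §1.5] -/
theorem applyFree_add_right_of_isArchSmooth_lieDeriv (hsm : isArchSmooth_lieDeriv (ι := ι))
    (p : FreeAlgebra ℝ H.lie) {φ ψ : G → ℂ} (hφ : IsArchSmooth ι φ) (hψ : IsArchSmooth ι ψ) :
    applyFree ι p (φ + ψ) = applyFree ι p φ + applyFree ι p ψ := by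
  unfold applyFree
  simp only [iterLieDeriv_add_of_isArchSmooth_lieDeriv ι hsm hφ hψ, smul_add,
    Finsupp.sum_add]

/-- For smooth `φ, ψ` the `Z(𝔤)`-orbit span of `φ + ψ` lies in the sum of those of `φ` and `ψ`
(any linear real group, granted `isArchSmooth_lieDeriv`). Borel–Jacquet 1979, §1.6. [cite: BorelJacquetCorvallis1979, §1.6] -/
theorem zOrbitSpan_add_le_of_isArchSmooth_lieDeriv (hsm : isArchSmooth_lieDeriv (ι := ι))
    {φ ψ : G → ℂ} (hφ : IsArchSmooth ι φ) (hψ : IsArchSmooth ι ψ) :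
    zOrbitSpan ι (φ + ψ) ≤ zOrbitSpan ι φ ⊔ zOrbitSpan ι ψ := by
  refine Submodule.span_le.2 ?_
  rintro _ ⟨p, hp, rfl⟩
  rw [SetLike.mem_coe, applyFree_add_right_of_isArchSmooth_lieDeriv ι hsm p hφ hψ]
  exact Submodule.add_mem_sup (Submodule.subset_span ⟨p, hp, rfl⟩)
    (Submodule.subset_span ⟨p, hp, rfl⟩)

/-- **`Z(𝔤)`-finiteness is additive on smooth functions** for any linear real group over
finite-dimensional coefficients, granted `isArchSmooth_lieDeriv`: `Z(φ + ψ) ⊆ Z φ + Z ψ`.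
Borel–Jacquet 1979, §1.6 and 4.3. [cite: BorelJacquetCorvallis1979, 4.3] -/
theorem IsZFinite.add_of_isArchSmooth_lieDeriv (hsm : isArchSmooth_lieDeriv (ι := ι))
    {φ ψ : G → ℂ} (hφs : IsArchSmooth ι φ) (hψs : IsArchSmooth ι ψ) (hφ : IsZFinite ι φ)
    (hψ : IsZFinite ι ψ) : IsZFinite ι (φ + ψ) := by
  unfold IsZFinite at hφ hψ ⊢
  haveI : FiniteDimensional ℂ ↥(zOrbitSpan ι φ ⊔ zOrbitSpan ι ψ) :=
    Submodule.finiteDimensional_sup _ _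
  exact Submodule.finiteDimensional_of_le
    (zOrbitSpan_add_le_of_isArchSmooth_lieDeriv ι hsm hφs hψs)

end ZFiniteGeneral

/-! ### Sums of automorphic forms; Borel–Jacquet 4.3, first assertion (any automorphy datum) -/

section SpanGeneral

variable {K : Type} [Field K] [NumberField K]
  {A : Type*} [NormedCommRing A] [NormedAlgebra ℝ A] [NormedAlgebra ℚ A] [CompleteSpace A]
  [StarRing A] {N : Type*} [Fintype N] [DecidableEq N]
  {𝒢 : AdelicGroupData K} {𝒟 : AutomorphyDatum 𝒢 A N}

/-- **Sums of automorphic forms are automorphic forms**, for any automorphy datum over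
finite-dimensional coefficients with directed levels, granted the named fact
`isArchSmooth_lieDeriv` for its archimedean group: left invariance, moderate growth and
`K_∞`-finiteness are linear, a common level exists by directedness, and `Z(𝔤)`-finiteness is
additive on smooth functions (`IsZFinite.add_of_isArchSmooth_lieDeriv`).
Borel–Jacquet 1979, 4.3 (first assertion). [cite: BorelJacquetCorvallis1979, 4.3] -/
theorem IsAutomorphicForm.add_of_isArchSmooth_lieDeriv [FiniteDimensional ℝ A]
    (hsm : isArchSmooth_lieDeriv (ι := 𝒟.ofArch)) (hdir : DirectedOn (· ≥ ·) 𝒟.finiteLevels)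
    {φ ψ : 𝒢.Adelic → ℂ} (hφ : IsAutomorphicForm 𝒟 φ) (hψ : IsAutomorphicForm 𝒟 ψ) :
    IsAutomorphicForm 𝒟 (φ + ψ) where
  leftInvariant γ hγ g := by
    simp only [Pi.add_apply, hφ.leftInvariant γ hγ g, hψ.leftInvariant γ hγ g]
  exists_level := by
    obtain ⟨U, hU, hφU⟩ := hφ.exists_level
    obtain ⟨V, hV, hψV⟩ := hψ.exists_level
    obtain ⟨W, hW, hWU, hWV⟩ := hdir U hU V hV
    exact ⟨W, hW, (hφU.anti hWU).add (hψV.anti hWV)⟩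
  archSmooth := hφ.archSmooth.add 𝒟.ofArch hψ.archSmooth
  kFinite := isKFinite_of_mem_span 𝒟.ofArch (S := {φ | IsKFinite 𝒟.ofArch φ}) (fun _ h ↦ h)
    (Submodule.add_mem _ (Submodule.subset_span hφ.kFinite) (Submodule.subset_span hψ.kFinite))
  zFinite := hφ.zFinite.add_of_isArchSmooth_lieDeriv 𝒟.ofArch hsm hφ.archSmooth hψ.archSmooth
    hψ.zFinite
  moderateGrowth := hφ.moderateGrowth.add hψ.moderateGrowth

/-- **Borel–Jacquet 4.3, first assertion, for any automorphy datum granted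
`isArchSmooth_lieDeriv`**: an element of the span of the automorphic forms is an automorphic
form (span induction with `isAutomorphicForm_zero`, `IsAutomorphicForm.add_of_isArchSmooth_lieDeriv`,
`IsAutomorphicForm.smul`), i.e. the named fact `mem_automorphicForms_iff 𝒟` of `AutomorphicForms`.
[cite: BorelJacquetCorvallis1979, 4.3] -/
theorem mem_automorphicForms_iff_of_isArchSmooth_lieDeriv
    (hsm : isArchSmooth_lieDeriv (ι := 𝒟.ofArch)) : mem_automorphicForms_iff 𝒟 := by
  intro _ hdir φ
  refine ⟨fun hφ ↦ ?_, fun hφ ↦ hφ.mem_automorphicForms⟩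
  induction hφ using Submodule.span_induction with
  | mem _ h => exact h
  | zero => exact isAutomorphicForm_zero 𝒟
  | add _ _ _ _ h₁ h₂ => exact h₁.add_of_isArchSmooth_lieDeriv hsm hdir h₂
  | smul c _ _ h => exact h.smul c

/-- **Discharge of the named fact `mem_automorphicForms_iff` of `AutomorphicForms`
(Borel–Jacquet 4.3, first assertion: the automorphic forms form a complex vector space, i.e. the
span `automorphicForms 𝒟` consists of automorphic forms)** for EVERY automorphy datum `𝒟`
over finite-dimensional coefficients with directed levels — no hypothesis on the archimedean
group `𝒟.arch` (its distinguished Lie algebra `𝔤 = 𝒟.arch.lie` need not be all of `𝔤𝔩(N, A)`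
nor the full Lie algebra of the closed group). The one analytic input, that Lie derivatives of
functions smooth along `g · exp 𝔤` are again smooth along `g · exp 𝔤`
(`isArchSmooth_lieDeriv_holds`, `ArchimedeanCalculusProofs`, via the exponential coordinates of
`Literature.Analysis.Calculus.ExpLocalLieSubalgebra`), makes the `Z(𝔤)`-action additive on
smooth functions (`IsZFinite.add_of_isArchSmooth_lieDeriv`); the rest is linear algebra
(`mem_automorphicForms_iff_of_isArchSmooth_lieDeriv`). In print: Borel–Jacquet, Corvallis
(1979), 4.2–4.3 ("the space `𝒜` of automorphic forms"), with §1.5–1.6 (`U(𝔤)` acts on smooth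
functions); Getz–Hahn (2024), Definition 6.5 ("the `ℂ`-vector space of automorphic forms").
[cite: BorelJacquetCorvallis1979, 4.3] -/
theorem mem_automorphicForms_iff_holds : mem_automorphicForms_iff 𝒟 :=
  mem_automorphicForms_iff_of_isArchSmooth_lieDeriv isArchSmooth_lieDeriv_holds

end SpanGeneral

end Literature.NumberTheory.Automorphic

/-!
# Appendix (2026-08-15): the Lie algebra action of an automorphic representation exists —
# discharge of `AutomorphicRepData.exists_hasLieAction` for every automorphy datum

The named fact `AutomorphicRepData.exists_hasLieAction π` of `AutomorphicForms` (Borel–Jacquet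
1979, 4.6 with §1.5: `W / W'` is a `(𝔤, K_∞) × G(𝔸_f)`-module, `𝔤` acting through the Lie
derivatives) is proved here for *every* automorphy datum over a finite-dimensional coefficient
algebra (no regularity needed): `AutomorphicRepData.exists_hasLieAction_holds`. The Lie algebra
`𝔤 = 𝒟.arch.lie` acts on `W / W'` through `X ↦ (φ ↦ X φ)`: `W`, `W'` are `𝔤`-stable spaces of
automorphic forms, hence of functions smooth in the archimedean variable, on which `X φ` is
`ℂ`-linear in `φ` (`IsArchSmooth.lieDeriv_add`, `lieDeriv_smul`), `ℝ`-linear in `X`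
(`IsArchSmooth.lieDeriv_add_left`, `IsArchSmooth.lieDeriv_smul_left`) and compatible with brackets,
`[X, Y] φ = X (Y φ) - Y (X φ)` — the latter for an ARBITRARY linear real group by `lieDeriv_bracket`
(`ArchimedeanApplyFreeCongr`, exponential coordinates along `𝔤`: the local closedness of `𝔤` under
`log (exp X exp Y)`, the Lie-subalgebra step of Hall 2015, Thm. 5.20, from
`Literature.Analysis.Calculus.ExpLocalLieSubalgebra`); the action on `W` descends to `W / W'` by
`Submodule.mapQ`. The
morphism `𝔤 →ₗ⁅ℝ⁆ End_ℂ (W / W')` is assembled inside the proof (it is unique,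
`hasLieAction_unique`); the tree's `AutomorphicRepLieActionGL` is the earlier special case of the
`GL_n` datum. Everything is proved; no new definitions or named facts. References: Borel–Jacquet
(1979), §1.5 and 4.6 [BorelJacquetCorvallis1979]; Getz–Hahn, GTM 300 (2024), Lemma 4.2.2 (the
`𝔤`-action on smooth vectors is a Lie algebra representation) and Definition 6.6.
-/

namespace Literature.NumberTheory.Automorphic

namespace AutomorphicRepData

section LieAction

variable {K : Type} [Field K] [NumberField K]
variable {A : Type*} [NormedCommRing A] [NormedAlgebra ℝ A] [NormedAlgebra ℚ A] [CompleteSpace A]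
  [StarRing A] {N : Type*} [Fintype N] [DecidableEq N]
variable {𝒢 : AdelicGroupData K} {𝒟 : AutomorphyDatum 𝒢 A N} (π : AutomorphicRepData 𝒟)

/-- Elements of `W` are smooth in the archimedean variable (`W ≤ 𝒜 ≤ archSmooth`). [folklore] -/
theorem isArchSmooth_coe (φ : π.W) : IsArchSmooth 𝒟.ofArch (φ : 𝒢.Adelic → ℂ) :=
  automorphicForms_le_archSmooth 𝒟 (π.stable.le_automorphicForms φ.2)

/-- The Lie derivative on `W` is additive in the direction: `(X + Y) φ = X φ + Y φ`. [folklore] -/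
theorem lieDerivW_add_left (X Y : 𝒟.arch.lie) (φ : π.W) :
    π.lieDerivW (X + Y) φ = π.lieDerivW X φ + π.lieDerivW Y φ :=
  Subtype.ext ((π.isArchSmooth_coe φ).lieDeriv_add_left 𝒟.ofArch X Y)

/-- The Lie derivative on `W` is `ℝ`-homogeneous in the direction: `(a • X) φ = a • X φ`.
[folklore] -/
theorem lieDerivW_smul_left (a : ℝ) (X : 𝒟.arch.lie) (φ : π.W) :
    π.lieDerivW (a • X) φ = a • π.lieDerivW X φ :=
  Subtype.ext ((π.isArchSmooth_coe φ).lieDeriv_smul_left 𝒟.ofArch a X)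

/-- **The bracket relation on `W`**: `[X, Y] φ = X (Y φ) - Y (X φ)` for `φ ∈ W`, for every
automorphy datum over a finite-dimensional coefficient algebra (`lieDeriv_bracket` for the linear
real group `𝒟.arch`). Borel–Jacquet 1979, §1.5. [cite: BorelJacquetCorvallis1979, §1.5] -/
theorem lieDerivW_bracket [FiniteDimensional ℝ A] (X Y : 𝒟.arch.lie) (φ : π.W) :
    π.lieDerivW ⁅X, Y⁆ φ = π.lieDerivW X (π.lieDerivW Y φ) - π.lieDerivW Y (π.lieDerivW X φ) :=
  Subtype.ext (lieDeriv_bracket 𝒟.ofArch X Y (π.isArchSmooth_coe φ))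

/-- **Discharge of `AutomorphicRepData.exists_hasLieAction`.** For every automorphic
representation datum `π = W / W'` of an automorphy datum `𝒟` over a finite-dimensional
coefficient algebra, the Lie algebra `𝔤 = 𝒟.arch.lie` acts on `W / W'` by a morphism of real
Lie algebras `ρ𝔤 : 𝔤 →ₗ⁅ℝ⁆ End_ℂ (W / W')` with `ρ𝔤 X [φ] = [X φ]` (`HasLieAction`; unique by
`hasLieAction_unique`): `X ↦ (φ ↦ X φ)` is `ℂ`-linear on `W` (`IsArchSmooth.lieDeriv_add`,
`lieDeriv_smul`), preserves `W'` (stability), is `ℝ`-linear in `X` and satisfies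
`[X, Y] φ = X (Y φ) - Y (X φ)` (`lieDerivW_bracket`, i.e. `lieDeriv_bracket` for the linear real
group `𝒟.arch`), and descends to the quotient (`Submodule.mapQ`). Borel–Jacquet 1979, §1.5 and
4.6 (`U(𝔤)` acts by left-invariant differential operators; `W / W'` is a
`(𝔤, K_∞) × G(𝔸_f)`-module); Getz–Hahn 2024, Lemma 4.2.2 and Definition 6.6.
[cite: BorelJacquetCorvallis1979, 4.6] -/
theorem exists_hasLieAction_holds : π.exists_hasLieAction := by
  intro _
  -- Mathlib idiom (Mathlib/Algebra/Lie/OfAssociative.lean): the commutator Lie ring on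
  -- `End_ℂ (W / W')`, as in the statement of the fact (`AutomorphicForms`)
  letI : LieRing (Module.End ℂ π.Quot) := LieRing.ofAssociativeRing
  -- the Lie derivative along `X` as a `ℂ`-linear endomorphism of `W`
  let L : 𝒟.arch.lie → (π.W →ₗ[ℂ] π.W) := fun X =>
    { toFun := fun φ => π.lieDerivW X φ
      map_add' := fun φ ψ => Subtype.ext
        (IsArchSmooth.lieDeriv_add 𝒟.ofArch X (π.isArchSmooth_coe φ) (π.isArchSmooth_coe ψ))
      map_smul' := fun c φ => Subtype.ext (lieDeriv_smul X c (φ : 𝒢.Adelic → ℂ)) }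
  -- `W'` is stable, so `L X` descends to `W / W'`
  have hker : ∀ X : 𝒟.arch.lie, π.kerQuot ≤ π.kerQuot.comap (L X) := fun X φ hφ => by
    simp only [kerQuot, Submodule.mem_comap, Submodule.subtype_apply] at hφ ⊢
    exact π.stable'.lie_stable X _ hφ
  let ρ : 𝒟.arch.lie → Module.End ℂ π.Quot := fun X => π.kerQuot.mapQ π.kerQuot (L X) (hker X)
  have hρ : ∀ (X : 𝒟.arch.lie) (φ : π.W),
      ρ X (Submodule.Quotient.mk φ) = Submodule.Quotient.mk (π.lieDerivW X φ) := fun _ _ => rfl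
  refine ⟨{ toFun := ρ, map_add' := ?_, map_smul' := ?_, map_lie' := ?_ }, fun X φ => hρ X φ⟩
  · intro X Y
    refine Submodule.linearMap_qext _ (LinearMap.ext fun φ => ?_)
    simp only [LinearMap.comp_apply, Submodule.mkQ_apply, LinearMap.add_apply, hρ,
      lieDerivW_add_left, Submodule.Quotient.mk_add]
  · intro a X
    refine Submodule.linearMap_qext _ (LinearMap.ext fun φ => ?_)
    simp only [LinearMap.comp_apply, Submodule.mkQ_apply, LinearMap.smul_apply, RingHom.id_apply, hρ,
      lieDerivW_smul_left, Submodule.Quotient.mk_smul]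
  · intro X Y
    refine Submodule.linearMap_qext _ (LinearMap.ext fun φ => ?_)
    simp only [LinearMap.comp_apply, Submodule.mkQ_apply, LieRing.of_associative_ring_bracket,
      LinearMap.sub_apply, Module.End.mul_apply, hρ, lieDerivW_bracket, Submodule.Quotient.mk_sub]

end LieAction

end AutomorphicRepData

end Literature.NumberTheory.Automorphic
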